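import Literature.NumberTheory.DiophantineGeometry.GenEllFullGalois
import Literature.IUT.LogVolume.FakeAdeleIndex
import Mathlib.NumberTheory.Chebyshev
import HarnessLib

/-!
# [GenEll] §4: primes of prescribed size (Lemma 4.1, Lemma 4.2, Corollaries 4.3, 4.4)

S. Mochizuki, *Arithmetic elliptic curves in general position*, Math. J. Okayama Univ. 52 (2010)
[cite: MochizukiGenEll2010] (kurims manuscript, Feb. 2009), pp. 20–23, read on the page:

> **Lemma 4.1. (The Existence of Primes of Prescribed Size)** Write `ℝ′_{>0} ⊆ ℝ_{>0}` for the
> complement in `ℝ_{>0}` of the set of prime numbers; `θ(x) := Σ_{p<x} log(p)` […] for `x ∈ ℝ′_{>0}`.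
> Let `M` be a positive integer; `ε, x_ε, C_ε ∈ ℝ_{>0}` such that `0 < ε < 1/4`, `ε · x_ε > C_ε`, and,
> moreover, we have: (i) `(5/4)·x + C_ε > θ(x)`, for all `x ∈ ℝ′_{>0}`; `θ(x) > (1 − ε)x`, for all
> `x ∈ ℝ′_{>0}` such that `x ≥ x_ε`; (ii) `M · log(x) ≤ ε · x`, for all `x ∈ ℝ_{>0}` such that `x ≥ x_ε`.
> Also, let us write `x_A := Σ_{p∈A} log(p)` for any finite set of prime numbers `A`. Then for any
> nonnegative `h ∈ ℝ` and any finite set of prime numbers `A` such that `x_A > x_ε`, there exist `M`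
> distinct prime numbers `p_1, …, p_M` such that `p_j ∉ A`, and `h ≤ p_j ≤ (1 + 6ε) · x_A + 8h`, for
> `j = 1, …, M`.
> **Lemma 4.2. (Some Elementary Estimates)** Let `n` be a positive integer; `p_1, …, p_n` prime
> numbers; `h_1, …, h_n` positive integers. Then we have
> `Σ log(p_j) ≤ h`; `Σ log(h_j) ≤ Σ log(h_j + 1) ≤ 3h/2` — where `h := Σ h_j · log(p_j)`.
> **Corollary 4.3 / 4.4** (Full Galois Actions for Degenerating Elliptic Curves / for Compactly Bounded
> Subsets): existence of primes `l∘, l• ∉ S` prime to the primes of potentially multiplicative reduction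
> and the local heights (and, for `l•`, to the primes ramified in `L` and the ramification indices),
> with `Im(Gal(Q̄/L) → GL₂(ℤ_{l∘})) ⊇ SL₂(ℤ_{l∘})`, `Gal(Q̄/L) → GL₂(ℤ_{l•})` surjective, and
> `l∘ ≤ 23040·900d·ht^Falt + 2x_S + C·d^{1+ε}`, `l• ≤ 23040·900d·ht^Falt + 6d·log-diff_{M_ell} + 2x_S +
> C·d^{1+ε}` (Cor. 4.3: `E_L` with a prime of potentially multiplicative reduction); the same with
> `23040·100d` and `C·d` for `[E_L] ∈ K_V` (Cor. 4.4).

## Rendering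

`θ` is Mathlib's `Chebyshev.theta` (`Σ_{p ≤ x}`; equal to the printed `Σ_{p<x}` off the primes, which is
why the paper restricts `x` to `ℝ′_{>0}`); `x_A = thetaFinset A`; the `l`-adic conclusions are rendered
as "for every `n ≥ 1`" statements about `E[l^n]` (`EllPoint.ImageModLContainsSL2 P (l^n)` of
`GenEllFullGalois.lean`; the tree's `WeierstrassCurve.HasSurjectiveModNGaloisRep (l^n)`), equivalent to
the printed ones since Galois images are closed; `log-diff_{M_ell}([E_L]) = [L:ℚ]⁻¹ log|disc L|` for the
minimal field of definition `L = ℚ(j)` ([GenEll] Def. 1.5 (iii)); the prime under `v` and the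
ramification index are `Literature.IUT.LogVolume.residueChar / ramIdx`. Lemma 4.2 is PROVED here; Lemma 4.1 and Remark 4.1.1 are PROVED in the tree already
(`GenEll.lemma41`, `GenEll.remark411`, `GenEll.lemma41_unconditional` in `GenEllPrimesOfPrescribedSize.lean`,
and `GenEll.exists_primes_prescribed_size` in `GenEllPrimesPrescribedSizeProof.lean`, other abc-iut seats)
and are not restated; Corollaries 4.3, 4.4 are named statements.
-/

noncomputable section

open NumberField IsDedekindDomain Finset

namespace Literature.NumberTheory.DiophantineGeometry.GenEll

/-- `x_A := Σ_{p ∈ A} log(p)` for a finite set of primes `A`. [cite: MochizukiGenEll2010, Lem 4.1 p.21] -/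
def thetaFinset (A : Finset ℕ) : ℝ := ∑ p ∈ A, Real.log p

/-- For a positive integer `H`, `log(H + 1) ≤ H · log 2` (`H + 1 ≤ 2^H`). [folklore] -/
private theorem log_succ_le (H : ℕ) (hH : 0 < H) : Real.log (H + 1) ≤ H * Real.log 2 := by
  have h2 : (H : ℝ) + 1 ≤ (2 : ℝ) ^ H := by
    have : H + 1 ≤ 2 ^ H := H.lt_two_pow_self
    exact_mod_cast this
  calc Real.log (H + 1) ≤ Real.log ((2 : ℝ) ^ H) :=
        Real.log_le_log (by positivity) h2
    _ = H * Real.log 2 := by rw [Real.log_pow]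

/-- **[GenEll] Lemma 4.2 (Some Elementary Estimates)**, PROVED: for primes `p_j` and positive integers
`h_j` (`j ∈ s`, a nonempty finite index set) and `h := Σ h_j log p_j`:
`Σ log p_j ≤ h`, `Σ log h_j ≤ Σ log(h_j + 1)` and `Σ log(h_j + 1) ≤ 3h/2` ("`log(H+1) ≤ (3H/2)·log(2)`").
[cite: MochizukiGenEll2010, Lem 4.2 p.21] -/
theorem GenEll_lemma42 {ι : Type*} (s : Finset ι) (p h : ι → ℕ) (hp : ∀ j ∈ s, (p j).Prime)
    (hh : ∀ j ∈ s, 0 < h j) :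
    (∑ j ∈ s, Real.log (p j)) ≤ ∑ j ∈ s, (h j : ℝ) * Real.log (p j) ∧
    (∑ j ∈ s, Real.log (h j)) ≤ ∑ j ∈ s, Real.log (h j + 1) ∧
    (∑ j ∈ s, Real.log (h j + 1)) ≤ 3 / 2 * ∑ j ∈ s, (h j : ℝ) * Real.log (p j) := by
  refine ⟨Finset.sum_le_sum fun j hj => ?_, Finset.sum_le_sum fun j hj => ?_, ?_⟩
  · have h1 : (1 : ℝ) ≤ h j := by exact_mod_cast hh j hj
    have hlog : 0 ≤ Real.log (p j) := Real.log_nonneg (by exact_mod_cast (hp j hj).one_lt.le)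
    nlinarith
  · exact Real.log_le_log (by exact_mod_cast hh j hj) (by linarith)
  · rw [Finset.mul_sum]
    refine Finset.sum_le_sum fun j hj => ?_
    have h2 : Real.log 2 ≤ Real.log (p j) :=
      Real.log_le_log two_pos (by exact_mod_cast (hp j hj).two_le)
    have hlog2 : 0 < Real.log 2 := Real.log_pos one_lt_two
    have hH : (0 : ℝ) < h j := by exact_mod_cast hh j hj
    calc Real.log (h j + 1) ≤ h j * Real.log 2 := log_succ_le (h j) (hh j hj)
      _ ≤ 3 / 2 * ((h j : ℝ) * Real.log (p j)) := by nlinarith [mul_le_mul_of_nonneg_left h2 hH.le]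

namespace EllPoint

/-- `log-diff_{M_ell}([E])` — the log-different of the minimal field of definition `L = ℚ(j(E))` of the
point `[E] ∈ M_ell(Q̄)` ([GenEll] Def. 1.5 (iii) for `X = M̄_ell`): `[F:ℚ]⁻¹ · log |disc F|` for a
minimal presentation. [cite: MochizukiGenEll2010, Def 1.5 (iii) p.8] -/
def logDiffMell (P : EllPoint) : ℝ :=
  (P.degree : ℝ)⁻¹ * Real.log ((NumberField.discr P.F).natAbs)

/-- "`l` is prime to the primes of potentially multiplicative reduction, as well as to the local
heights, of `E_L`": `l` differs from the residue characteristic of every such prime and divides no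
local height there. [cite: MochizukiGenEll2010, Cor 4.3 (a) p.22] -/
def PrimeToPotMultData (P : EllPoint) (l : ℕ) : Prop :=
  ∀ v : HeightOneSpectrum (𝓞 P.F), P.IsPotMult v →
    l ≠ Literature.IUT.LogVolume.residueChar P.F v ∧ ¬ ((l : ℤ) ∣ P.localHeight v)

/-- "`l` is prime to the primes of `ℚ` that ramify in `L`, as well as to the ramification indices of
primes of `ℚ` in `L`": `l ∤ disc(L)` and `l ∤ e(v|p)` for every finite prime `v` of `L`.
[cite: MochizukiGenEll2010, Cor 4.3 (a) p.22] -/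
def PrimeToRamificationData (P : EllPoint) (l : ℕ) : Prop :=
  ¬ ((l : ℤ) ∣ NumberField.discr P.F) ∧
    ∀ v : HeightOneSpectrum (𝓞 P.F), ¬ (l ∣ Literature.IUT.LogVolume.ramIdx P.F v)

/-- "The image of `Gal(Q̄/L) → GL₂(ℤ_l)` contains `SL₂(ℤ_l)`", rendered level by level (the image is
closed): for every `n ≥ 1` the image in `Aut(E[l^n])` contains the elements of determinant `1`.
[cite: MochizukiGenEll2010, Cor 4.3 (b) p.22] -/
def LAdicImageContainsSL2 (P : EllPoint) (l : ℕ) [Fact l.Prime] : Prop :=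
  ∀ n : ℕ, 0 < n → P.ImageModLContainsSL2 (l ^ n)

/-- "The Galois representation `Gal(Q̄/L) → GL₂(ℤ_l)` is surjective", level by level: every mod-`l^n`
representation is surjective (the tree's `WeierstrassCurve.HasSurjectiveModNGaloisRep`).
[cite: MochizukiGenEll2010, Cor 4.3 (b) p.22] -/
def LAdicImageSurjective (P : EllPoint) (l : ℕ) : Prop :=
  ∀ n : ℕ, 0 < n → P.W.HasSurjectiveModNGaloisRep ((l ^ n : ℕ) : ℤ)

end EllPoint

/-- NAMED FACT — **[GenEll] Corollary 4.3 (Full Galois Actions for Degenerating Elliptic Curves)**: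
for every `ε > 0` there are `C > 0` and a Galois-finite `Exc` such that for every elliptic curve `E_L`
over a MINIMAL field of definition `L` of `[E_L]`, `[E_L] ∉ Exc`, with a prime of potentially
multiplicative reduction, and every finite set of primes `S`, there exist primes `l∘, l• ∉ S` with
(a) both prime to the potentially-multiplicative data, `l•` moreover prime to the ramification data of
`L`; (b) `Im ⊇ SL₂(ℤ_{l∘})`, `ρ_{l•}` surjective; (c) `l∘ ≤ 23040·900d·ht^Falt + 2x_S + C·d^{1+ε}`,
`l• ≤ 23040·900d·ht^Falt + 6d·log-diff_{M_ell} + 2x_S + C·d^{1+ε}`. [cite: MochizukiGenEll2010, Cor 4.3 p.22] -/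
def GenEll_cor43 : Prop :=
  ∀ ε : ℝ, 0 < ε → ∃ C : ℝ, 0 < C ∧ ∃ Exc : Set (Polynomial ℚ), MellExcGaloisFinite Exc ∧
    ∀ (P : EllPoint) (S : Finset ℕ), (∀ p ∈ S, p.Prime) → P.IsMinimal → ¬ MellExcMem Exc P →
      P.HasPotMultPlace →
      ∃ lo lb : ℕ, ∃ (_ : Fact lo.Prime) (_ : Fact lb.Prime), lo ∉ S ∧ lb ∉ S ∧
        P.PrimeToPotMultData lo ∧ P.PrimeToPotMultData lb ∧ P.PrimeToRamificationData lb ∧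
        P.LAdicImageContainsSL2 lo ∧ P.LAdicImageSurjective lb ∧
        (lo : ℝ) ≤ 23040 * 900 * P.degree * P.htFalt + 2 * thetaFinset S + C * (P.degree : ℝ) ^ (1 + ε) ∧
        (lb : ℝ) ≤ 23040 * 900 * P.degree * P.htFalt + 6 * P.degree * P.logDiffMell +
          2 * thetaFinset S + C * (P.degree : ℝ) ^ (1 + ε)

/-- NAMED FACT — **[GenEll] Corollary 4.4 (Full Galois Actions for Compactly Bounded Subsets)**: for
every compactly bounded `K_V ⊆ M_ell(Q̄)` there are `C > 0` and a Galois-finite `Exc` such that for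
every `E_L` over a minimal field of definition `L`, `[E_L] ∈ K_V`, `[E_L] ∉ Exc`, and every finite set
of primes `S`, there exist primes `l∘, l• ∉ S` with (a), (b) as in Cor. 4.3 and
(c) `l∘ ≤ 23040·100d·ht^Falt + 2x_S + C·d`, `l• ≤ 23040·100d·ht^Falt + 6d·log-diff_{M_ell} + 2x_S + C·d`
(with the correction [IUTchIV] Rmk. 2.3.1 (iii), (iv) to the printed text).
[cite: MochizukiGenEll2010, Cor 4.4 p.23] -/
def GenEll_cor44 : Prop :=
  ∀ D : MellCBData, ∃ C : ℝ, 0 < C ∧ ∃ Exc : Set (Polynomial ℚ), MellExcGaloisFinite Exc ∧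
    ∀ (P : EllPoint) (S : Finset ℕ), (∀ p ∈ S, p.Prime) → P.IsMinimal → D.Mem P → ¬ MellExcMem Exc P →
      ∃ lo lb : ℕ, ∃ (_ : Fact lo.Prime) (_ : Fact lb.Prime), lo ∉ S ∧ lb ∉ S ∧
        P.PrimeToPotMultData lo ∧ P.PrimeToPotMultData lb ∧ P.PrimeToRamificationData lb ∧
        P.LAdicImageContainsSL2 lo ∧ P.LAdicImageSurjective lb ∧
        (lo : ℝ) ≤ 23040 * 100 * P.degree * P.htFalt + 2 * thetaFinset S + C * P.degree ∧
        (lb : ℝ) ≤ 23040 * 100 * P.degree * P.htFalt + 6 * P.degree * P.logDiffMell +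
          2 * thetaFinset S + C * P.degree

end Literature.NumberTheory.DiophantineGeometry.GenEll

end
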